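import Mathlib
import HarnessLib
import Literature.MathematicalPhysics.QuantumFieldTheory.ConstructiveQFTWave0
import Summits.Ventures.LatticeQCDFlow.Scaling.SparsePatchSectors
import Summits.Ventures.LatticeQCDFlow.Scaling.SparsePatchSectorsLattice
import Summits.Ventures.LatticeQCDFlow.Scaling.SparsePatchSectorsLatticeGroups

/-!
# LatticeQCDFlow / Scaling — the EXPOSED-PATCH tunnelling law, abstract part (v3.2, item 85a)

HONEST FRAMING: exact (Metropolis-corrected) sampling algorithms for lattice gauge theory; figures
of merit are autocorrelation/cost numbers at stated couplings and volumes; no continuum-physics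
claim.

THEORY-2.md §3.3 / conjecture C7(b), SECOND STEP.  `Scaling/SparsePatchSectors(Lattice).lean` proved
the patch law for PLAQUETTE-SPARSE update sets (one updated slot per plaquette).  Sparsity is not what
the argument needs: it needs every updated link to be EXPOSED — to be a slot of SOME plaquette whose
other slots are not updated and which DETECTS that slot (`dist (U_e, V_e) ≤ a_p(U) + a_p(V)` when `U = V`
on the other slots).  Then the two configurations are `2c`-close linkwise on the whole patch, and along
the linkwise local path of radius `r` a plaquette with `k ≤ #S` updated slots moves by `≤ k·r`.  Hence,
with `2c ≤ ρ` and `c + #S·r ≤ ε`: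

* `Tunnelling.mem_connectedComponentIn_of_exposedPatch`, `exposedPatch_separates`,
  **`compProd_sector_ne_le_of_exposedPatch`** (+ `_add`, `measure_sector_ne_le_nsteps_of_exposedPatches`)
  — the abstract law: `(μ ⊗ₘ κ){sector ≠ sector'} ≤ 2·μ{∃ p touching Λ, c ≤ a p}` for every
  `μ`-invariant kernel moving only an exposed `Λ`.

The lattice instances (every slot detects; SLABS — one plaquette, planar patches, all spatial links of a
time slice — are exposed; `SU(N)` with `2c ≤ r₀(N)`, `9c ≤ ε`; `U(N)` with `c ≤ 1/16`, `17c ≤ ε`) are in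
the sibling `Scaling/ExposedPatchSectorsLattice.lean`.  No sorry, no new axioms, no `def`.
-/

noncomputable section

open scoped Matrix.Norms.Frobenius ENNReal ProbabilityTheory
open MeasureTheory ProbabilityTheory Metric Set
open Literature.MathematicalPhysics.QuantumFieldTheory

namespace Summit.Ventures.LatticeQCDFlow.Theory2.Tunnelling

/-! ## §1. The abstract exposed-patch lemma and law -/

section Separating

variable {E Y ι S : Type*} [PseudoMetricSpace Y] [Fintype S]

/-- **Key lemma (exposed patches stay in the sector).**  Configurations agreeing off a link set `Λ`
every member of which is EXPOSED (a slot of a plaquette whose other slots avoid `Λ`), with every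
plaquette touching `Λ` of defect `< c` in both and the first admissible at level `ε`, lie in one
connected component of `{W | ∀ p, a p W < ε}` — provided every slot detects, `Y` has `(ρ, r)`-local
paths, `2c ≤ ρ` and `c + #S·r ≤ ε`. [folklore] -/
theorem mem_connectedComponentIn_of_exposedPatch {a : ι → (E → Y) → ℝ} {slot : ι → S → E}
    (hlip : ∀ p (U V : E → Y), a p V ≤ a p U + ∑ s, dist (U (slot p s)) (V (slot p s)))
    (hdet : ∀ p s (U V : E → Y), (∀ s', s' ≠ s → U (slot p s') = V (slot p s')) →
      dist (U (slot p s)) (V (slot p s)) ≤ a p U + a p V)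
    {Λ : Set E} (hexp : ∀ e ∈ Λ, ∃ p s, slot p s = e ∧ ∀ s', s' ≠ s → slot p s' ∉ Λ)
    {ρ r : ℝ} (hr : 0 ≤ r)
    (hpath : ∀ y y' : Y, dist y y' ≤ ρ → ∃ γ : ℝ → Y, ContinuousOn γ (Icc (0 : ℝ) 1) ∧ γ 0 = y ∧
      γ 1 = y' ∧ ∀ t ∈ Icc (0 : ℝ) 1, dist (γ t) y ≤ r)
    {c ε : ℝ} (hcρ : 2 * c ≤ ρ) (hcr : c + Fintype.card S * r ≤ ε)
    {U V : E → Y} (hUV : ∀ e ∉ Λ, U e = V e)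
    (hU : ∀ p s, slot p s ∈ Λ → a p U < c) (hV : ∀ p s, slot p s ∈ Λ → a p V < c)
    (hUadm : ∀ p, a p U < ε) :
    V ∈ connectedComponentIn {W | ∀ p, a p W < ε} U := by
  classical
  -- the updated links move by at most `ρ`
  have hsmall : ∀ e ∈ Λ, dist (U e) (V e) ≤ ρ := by
    intro e he
    obtain ⟨p, s, hps, hout⟩ := hexp e he
    have hs : slot p s ∈ Λ := by rw [hps]; exact he
    have hagree : ∀ s', s' ≠ s → U (slot p s') = V (slot p s') :=
      fun s' hs' => hUV _ (hout s' hs')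
    have h1 := hdet p s U V hagree
    rw [hps] at h1
    have h2 := hU p s hs
    have h3 := hV p s hs
    linarith
  -- linkwise paths: the local path on updated links, the constant path elsewhere
  have hex : ∀ e, ∃ γ : ℝ → Y, ContinuousOn γ (Icc (0 : ℝ) 1) ∧ γ 0 = U e ∧ γ 1 = V e ∧
      (∀ t ∈ Icc (0 : ℝ) 1, dist (γ t) (U e) ≤ r) ∧ (e ∉ Λ → ∀ t, γ t = U e) := by
    intro e
    by_cases he : e ∈ Λ
    · obtain ⟨γ, hγc, hγ0, hγ1, hγd⟩ := hpath (U e) (V e) (hsmall e he)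
      exact ⟨γ, hγc, hγ0, hγ1, hγd, fun h => absurd he h⟩
    · exact ⟨fun _ => U e, continuousOn_const, rfl, hUV e he,
        fun t _ => by rw [dist_self]; exact hr, fun _ _ => rfl⟩
  choose γ hγc hγ0 hγ1 hγd hγconst using hex
  set W : ℝ → (E → Y) := fun t e => γ e t with hW
  have hWc : ContinuousOn W (Icc (0 : ℝ) 1) := continuousOn_pi.2 fun e => hγc e
  have hW0 : W 0 = U := funext fun e => hγ0 e
  have hW1 : W 1 = V := funext fun e => hγ1 e
  -- admissibility along the path: a touched plaquette moves by `≤ #S·r`, an untouched one not at all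
  have hadm : ∀ t ∈ Icc (0 : ℝ) 1, ∀ p, a p (W t) < ε := by
    intro t ht p
    have hl := hlip p U (W t)
    by_cases hp : ∃ s, slot p s ∈ Λ
    · obtain ⟨s, hs⟩ := hp
      have hsum : ∑ s', dist (U (slot p s')) (W t (slot p s')) ≤ Fintype.card S * r := by
        calc ∑ s', dist (U (slot p s')) (W t (slot p s')) ≤ ∑ _s' : S, r :=
              Finset.sum_le_sum fun s' _ => by
                show dist (U (slot p s')) (γ (slot p s') t) ≤ r
                rw [dist_comm]; exact hγd (slot p s') t ht
          _ = Fintype.card S * r := by rw [Finset.sum_const, Finset.card_univ, nsmul_eq_mul]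
      have := hU p s hs
      linarith
    · push Not at hp
      have hsum : ∑ s', dist (U (slot p s')) (W t (slot p s')) = 0 := by
        refine Finset.sum_eq_zero fun s' _ => ?_
        show dist (U (slot p s')) (γ (slot p s') t) = 0
        rw [hγconst (slot p s') (hp s') t, dist_self]
      have := hUadm p
      linarith
  have hsub : W '' Icc (0 : ℝ) 1 ⊆ {W | ∀ p, a p W < ε} := by
    rintro _ ⟨t, ht, rfl⟩
    exact hadm t ht
  have h := (isPreconnected_Icc.image W hWc).subset_connectedComponentIn
    ⟨0, left_mem_Icc.2 zero_le_one, hW0⟩ hsub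
  exact h ⟨1, right_mem_Icc.2 zero_le_one, hW1⟩

/-- **Separating lemma for exposed patches.** [folklore] -/
theorem exposedPatch_separates {a : ι → (E → Y) → ℝ} {slot : ι → S → E}
    (hlip : ∀ p (U V : E → Y), a p V ≤ a p U + ∑ s, dist (U (slot p s)) (V (slot p s)))
    (hdet : ∀ p s (U V : E → Y), (∀ s', s' ≠ s → U (slot p s') = V (slot p s')) →
      dist (U (slot p s)) (V (slot p s)) ≤ a p U + a p V)
    {Λ : Set E} (hexp : ∀ e ∈ Λ, ∃ p s, slot p s = e ∧ ∀ s', s' ≠ s → slot p s' ∉ Λ)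
    {ρ r : ℝ} (hr : 0 ≤ r)
    (hpath : ∀ y y' : Y, dist y y' ≤ ρ → ∃ γ : ℝ → Y, ContinuousOn γ (Icc (0 : ℝ) 1) ∧ γ 0 = y ∧
      γ 1 = y' ∧ ∀ t ∈ Icc (0 : ℝ) 1, dist (γ t) y ≤ r)
    {c ε : ℝ} (hcρ : 2 * c ≤ ρ) (hcr : c + Fintype.card S * r ≤ ε)
    {U V : E → Y} (hUV : ∀ e ∉ Λ, U e = V e)
    (hne : connectedComponentIn {W | ∀ p, a p W < ε} U ≠ connectedComponentIn {W | ∀ p, a p W < ε} V) :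
    U ∈ {U : E → Y | ∃ p s, slot p s ∈ Λ ∧ c ≤ a p U} ∨
      V ∈ {U : E → Y | ∃ p s, slot p s ∈ Λ ∧ c ≤ a p U} := by
  by_contra h
  simp only [mem_setOf_eq, not_or, not_exists, not_and, not_le] at h
  obtain ⟨hU, hV⟩ := h
  by_cases hUadm : ∀ p, a p U < ε
  · exact hne (connectedComponentIn_eq
      (mem_connectedComponentIn_of_exposedPatch hlip hdet hexp hr hpath hcρ hcr hUV hU hV hUadm))
  · push Not at hUadm
    obtain ⟨p, hp⟩ := hUadm
    have hS : (0 : ℝ) ≤ Fintype.card S * r := mul_nonneg (Nat.cast_nonneg _) hr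
    have hc : c ≤ ε := by linarith
    have hpΛ : ∀ s, slot p s ∉ Λ := fun s hs => absurd (hU p s hs) (not_lt.2 (hc.trans hp))
    have hVp : ε ≤ a p V := by
      have hl := hlip p V U
      have hsum : ∑ s, dist (V (slot p s)) (U (slot p s)) = 0 :=
        Finset.sum_eq_zero fun s _ => by rw [hUV _ (hpΛ s), dist_self]
      linarith
    have hUe : connectedComponentIn {W : E → Y | ∀ p, a p W < ε} U = ∅ :=
      connectedComponentIn_eq_empty fun h => (not_lt.2 hp) (h p)
    have hVe : connectedComponentIn {W : E → Y | ∀ p, a p W < ε} V = ∅ :=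
      connectedComponentIn_eq_empty fun h => (not_lt.2 hVp) (h p)
    exact hne (hUe.trans hVe.symm)

end Separating

section Laws

variable {E Y ι S : Type*} [PseudoMetricSpace Y] [Fintype S] [MeasurableSpace (E → Y)]

/-- **Exposed-patch tunnelling law (one step).**  `(μ ⊗ₘ κ){sector ≠ sector'} ≤ 2·μ{∃ p touching Λ,
c ≤ a p}` for every s-finite `μ` and every `μ`-invariant Markov kernel moving a.s. only the links of an
exposed set `Λ`; thresholds `2c ≤ ρ`, `c + #S·r ≤ ε`. [folklore] -/
theorem compProd_sector_ne_le_of_exposedPatch {a : ι → (E → Y) → ℝ} {slot : ι → S → E}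
    (hlip : ∀ p (U V : E → Y), a p V ≤ a p U + ∑ s, dist (U (slot p s)) (V (slot p s)))
    (hdet : ∀ p s (U V : E → Y), (∀ s', s' ≠ s → U (slot p s') = V (slot p s')) →
      dist (U (slot p s)) (V (slot p s)) ≤ a p U + a p V)
    {Λ : Set E} (hexp : ∀ e ∈ Λ, ∃ p s, slot p s = e ∧ ∀ s', s' ≠ s → slot p s' ∉ Λ)
    {ρ r : ℝ} (hr : 0 ≤ r)
    (hpath : ∀ y y' : Y, dist y y' ≤ ρ → ∃ γ : ℝ → Y, ContinuousOn γ (Icc (0 : ℝ) 1) ∧ γ 0 = y ∧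
      γ 1 = y' ∧ ∀ t ∈ Icc (0 : ℝ) 1, dist (γ t) y ≤ r)
    {c ε : ℝ} (hcρ : 2 * c ≤ ρ) (hcr : c + Fintype.card S * r ≤ ε)
    (μ : Measure (E → Y)) [SFinite μ] (κ : Kernel (E → Y) (E → Y)) [IsMarkovKernel κ]
    (hinv : κ.Invariant μ) (hΛ : ∀ᵐ q ∂(μ ⊗ₘ κ), ∀ e ∉ Λ, q.1 e = q.2 e) :
    (μ ⊗ₘ κ) {q | connectedComponentIn {W | ∀ p, a p W < ε} q.1 ≠
        connectedComponentIn {W | ∀ p, a p W < ε} q.2} ≤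
      2 * μ {U | ∃ p s, slot p s ∈ Λ ∧ c ≤ a p U} :=
  compProd_chargeChange_le_of_invariant (R := fun U V : E → Y => ∀ e ∉ Λ, U e = V e)
    (Q := fun U : E → Y => connectedComponentIn {W | ∀ p, a p W < ε} U)
    (B := {U : E → Y | ∃ p s, slot p s ∈ Λ ∧ c ≤ a p U})
    (fun _ _ hUV hne => exposedPatch_separates hlip hdet hexp hr hpath hcρ hcr hUV hne) μ κ hinv hΛ

/-- **Exposed-patch law with an exceptional set.** [folklore] -/
theorem compProd_sector_ne_le_of_exposedPatch_add {a : ι → (E → Y) → ℝ} {slot : ι → S → E}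
    (hlip : ∀ p (U V : E → Y), a p V ≤ a p U + ∑ s, dist (U (slot p s)) (V (slot p s)))
    (hdet : ∀ p s (U V : E → Y), (∀ s', s' ≠ s → U (slot p s') = V (slot p s')) →
      dist (U (slot p s)) (V (slot p s)) ≤ a p U + a p V)
    {Λ : Set E} (hexp : ∀ e ∈ Λ, ∃ p s, slot p s = e ∧ ∀ s', s' ≠ s → slot p s' ∉ Λ)
    {ρ r : ℝ} (hr : 0 ≤ r)
    (hpath : ∀ y y' : Y, dist y y' ≤ ρ → ∃ γ : ℝ → Y, ContinuousOn γ (Icc (0 : ℝ) 1) ∧ γ 0 = y ∧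
      γ 1 = y' ∧ ∀ t ∈ Icc (0 : ℝ) 1, dist (γ t) y ≤ r)
    {c ε : ℝ} (hcρ : 2 * c ≤ ρ) (hcr : c + Fintype.card S * r ≤ ε)
    (μ : Measure (E → Y)) [SFinite μ] (κ : Kernel (E → Y) (E → Y)) [IsMarkovKernel κ]
    (hinv : κ.Invariant μ) :
    (μ ⊗ₘ κ) {q | connectedComponentIn {W | ∀ p, a p W < ε} q.1 ≠
        connectedComponentIn {W | ∀ p, a p W < ε} q.2} ≤
      2 * μ {U | ∃ p s, slot p s ∈ Λ ∧ c ≤ a p U} + (μ ⊗ₘ κ) {q | ¬ ∀ e ∉ Λ, q.1 e = q.2 e} :=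
  compProd_chargeChange_le_add_of_invariant (R := fun U V : E → Y => ∀ e ∉ Λ, U e = V e)
    (Q := fun U : E → Y => connectedComponentIn {W | ∀ p, a p W < ε} U)
    (B := {U : E → Y | ∃ p s, slot p s ∈ Λ ∧ c ≤ a p U})
    (fun _ _ hUV hne => exposedPatch_separates hlip hdet hexp hr hpath hcρ hcr hUV hne) μ κ hinv

/-- **`n`-step law for exposed patches** (`k`-th step changes only the exposed set `Λ k`; all one-time
marginals `m`): `P{sector(Z n) ≠ sector(Z 0)} ≤ n·2·M`. [folklore] -/
theorem measure_sector_ne_le_nsteps_of_exposedPatches {a : ι → (E → Y) → ℝ} {slot : ι → S → E}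
    (hlip : ∀ p (U V : E → Y), a p V ≤ a p U + ∑ s, dist (U (slot p s)) (V (slot p s)))
    (hdet : ∀ p s (U V : E → Y), (∀ s', s' ≠ s → U (slot p s') = V (slot p s')) →
      dist (U (slot p s)) (V (slot p s)) ≤ a p U + a p V)
    {Λ : ℕ → Set E} (hexp : ∀ k, ∀ e ∈ Λ k, ∃ p s, slot p s = e ∧ ∀ s', s' ≠ s → slot p s' ∉ Λ k)
    {ρ r : ℝ} (hr : 0 ≤ r)
    (hpath : ∀ y y' : Y, dist y y' ≤ ρ → ∃ γ : ℝ → Y, ContinuousOn γ (Icc (0 : ℝ) 1) ∧ γ 0 = y ∧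
      γ 1 = y' ∧ ∀ t ∈ Icc (0 : ℝ) 1, dist (γ t) y ≤ r)
    {c ε : ℝ} (hcρ : 2 * c ≤ ρ) (hcr : c + Fintype.card S * r ≤ ε)
    {Ω : Type*} [MeasurableSpace Ω] (P : Measure Ω) (Z : ℕ → Ω → (E → Y))
    (hZ : ∀ k, Measurable (Z k)) (m : Measure (E → Y)) (hmarg : ∀ k, P.map (Z k) = m)
    (hstep : ∀ k, ∀ᵐ ω ∂P, ∀ e ∉ Λ k, Z k ω e = Z (k + 1) ω e) {M : ℝ≥0∞}
    (hM : ∀ k, m {U | ∃ p s, slot p s ∈ Λ k ∧ c ≤ a p U} ≤ M) (n : ℕ) :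
    P {ω | connectedComponentIn {W | ∀ p, a p W < ε} (Z n ω) ≠
        connectedComponentIn {W | ∀ p, a p W < ε} (Z 0 ω)} ≤ n * (2 * M) := by
  refine measure_chargeChange_le_nsteps (R := fun k (U V : E → Y) => ∀ e ∉ Λ k, U e = V e)
    (Q := fun U : E → Y => connectedComponentIn {W | ∀ p, a p W < ε} U)
    (B := fun k => {U : E → Y | ∃ p s, slot p s ∈ Λ k ∧ c ≤ a p U})
    (fun k _ _ hUV hne => exposedPatch_separates hlip hdet (hexp k) hr hpath hcρ hcr hUV hne)
    P Z hstep (fun k => ?_) n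
  have h1 : ∀ j, P (Z j ⁻¹' {U : E → Y | ∃ p s, slot p s ∈ Λ k ∧ c ≤ a p U}) ≤ M := fun j => by
    calc P (Z j ⁻¹' {U : E → Y | ∃ p s, slot p s ∈ Λ k ∧ c ≤ a p U})
        ≤ P.map (Z j) {U : E → Y | ∃ p s, slot p s ∈ Λ k ∧ c ≤ a p U} :=
          Measure.le_map_apply (hZ j).aemeasurable _
      _ ≤ M := by rw [hmarg j]; exact hM k
  calc P (Z k ⁻¹' {U : E → Y | ∃ p s, slot p s ∈ Λ k ∧ c ≤ a p U}) +
        P (Z (k + 1) ⁻¹' {U : E → Y | ∃ p s, slot p s ∈ Λ k ∧ c ≤ a p U}) ≤ M + M :=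
        add_le_add (h1 k) (h1 (k + 1))
    _ = 2 * M := (two_mul M).symm

end Laws

end Summit.Ventures.LatticeQCDFlow.Theory2.Tunnelling
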